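import Literature.AnabelianGeometry.AbsoluteAnabelian.NumberFieldValuationProSetArchDictionaryProofs
import Literature.AnabelianGeometry.AbsoluteAnabelian.NumberFieldValuationProSetDecomposition
import Literature.AnabelianGeometry.AbsoluteAnabelian.GaloisTheatersNumberFieldShadowDecomposition
import HarnessLib

/-!
# [AbsTopIII] Rmk 5.1.1 at the GENUINE pro-set `V⊚(F̄/F)`: nonarchimedean local elements are separated by
# their decomposition groups; equivariant bijections are unique on `V^non` (and on real-type `V^arc`)

S. Mochizuki, *Topics in absolute anabelian geometry III* [MochizukiAbsTopIII2015], Def 5.1 (i)/(iii) pp. 113–115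
(the pro-set `V⊚(F̄/F)` with its `G_F`-action; `Π_v` = the stabiliser of `v`) and Rmk 5.1.1 p. 118: "for
nonarchimedean elements, this follows from the well-known fact that a nonarchimedean prime is uniquely determined
by any open subgroup of its decomposition group [NSW, Cor 12.1.3]".  Neukirch–Schmidt–Wingberg, *Cohomology of
Number Fields* [NeukirchSchmidtWingberg2008], Cor. 12.1.3.

PROOF-ONLY companion (0 `def`s, 0 `Prop` facts, no `instance`/`notation`) of abc-iut-L4-d2's genuine pro-set
`NumberField.valuationProSet F` (`NumberFieldValuationProSet.lean`) — written by abc-iut-w6-d038 (gen 3) as the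
successor item named in abc-iut-L4-d2's «CANONICAL-N1» note (GAP G-L4d2g4-1 lineage).  It transports the
valuation-subring rigidity theorems of `NFDecompositionNestedProofs.lean` / `NFDecompositionNonCommensurableProofs.lean`
(abc-iut-w6-d038 gen 2: `eq_of_decompositionGroupNF_le`, `eq_of_relIndex_decompositionGroupNF_ne_zero`) to the
carrier of `V⊚(F̄/F)`, `F` a number field:

* (by name from abc-iut-f-104's `NumberFieldValuationProSetDecomposition.lean`: `decomp_inr_inl_eq_decompositionGroupNF`
  — the decomposition group of the nonarchimedean local element `A` IS `decompositionGroupNF F A`, [AbsAnab] §1.1);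
* **(R1)** `nonArch_eq_of_decomp_le` / `nonArch_eq_of_decomp_eq` / `decomp_nonArch_injective` — `Π_A ≤ Π_B ⇒ A = B`
  on `V^non` ([NSW] Cor. 12.1.3, nested form); `nonArch_eq_of_isOpen_inf_decomp_le` — `U ∩ Π_A ⊆ Π_B` for an OPEN
  subgroup `U ⊆ G_F` already forces `A = B` (the "any open subgroup of its decomposition group" form);
* **(R2)** `eq_of_mem_non_of_decomp_le` / `eq_of_mem_non_of_decomp_eq` / `eq_of_mem_non_of_isOpen_inf_decomp_le`,
  packaged as `decomp_separates_non` and `isOpen_inf_decomp_separates_non` — LITERALLY the two `hnon` binders of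
  `GaloisTheatersRmk511.referenceIsoUnique_of_separated` / `theaterHomDeterminedByGroupHom_of_separated`
  (abc-iut cell, `GaloisTheatersRmk511.lean`) read at the genuine pro-set;
* **(R3)** the MECHANISM of Rmk 5.1.1, UNCONDITIONALLY: for a group automorphism `α` of `G_F`, an `α`-equivariant
  BIJECTION `ψ` of `V⊚(F̄/F)` satisfies `Π_{ψ v} = α(Π_v)` (`GaloisProSet.decomp_apply_eq_map_of_equivariant`,
  valid for every `GaloisProSet`); hence two such bijections preserving `V^non` AGREE on `V^non`
  (`apply_eq_of_equivariant_of_mem_non`; `α = 1`: `apply_eq_self_of_equivariant_of_mem_non`), and two such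
  bijections preserving `V^arc` agree on every archimedean element with NON-TRIVIAL decomposition group — the
  elements above real places (`apply_eq_of_equivariant_of_mem_arc_of_decomp_ne_bot`, from
  `decomp_arch_injective_of_ne_bot`, Artin–Schreier, abc-iut-w5-d214 / ArchDictionaryProofs BY NAME).

HONEST SCOPE: archimedean elements above COMPLEX places of `F` have trivial decomposition group and are NOT pinned
by (R3) (print separates archimedean elements by the `κ_v`-induced topologies instead — the `harc` binder, not
addressed here).  Nothing here uses [NSW] (12.1.9) or the Neukirch–Uchida fact; nothing bears on [IUTchIII]
Cor. 3.12 or takes a side; classical algebraic number theory.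
-/

noncomputable section

open scoped Pointwise Topology
open NumberField

universe u

namespace Literature.AnabelianGeometry.AbsoluteAnabelian

/-! ### (R3, abstract) Equivariant bijections transport decomposition groups — any `GaloisProSet` -/

/-- For ANY Galois pro-set `V` over `Π`, a group automorphism `α` of `Π` and a BIJECTION `ψ` of `V` with
`ψ (g • v) = α g • ψ v`: the decomposition group of `ψ v` is `α(Π_v)`.  (The computation behind Rmk 5.1.1:
"`ψ₂⁻¹ ∘ ψ₁` is `Π`-equivariant, so preserves decomposition groups".) [cite: MochizukiAbsTopIII2015, Rmk 5.1.1 p.118] -/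
theorem GaloisProSet.decomp_apply_eq_map_of_equivariant {P : Type u} [Group P] [TopologicalSpace P]
    (V : GaloisProSet P) (α : P ≃* P) (ψ : V.carrier ≃ V.carrier)
    (hψ : ∀ (g : P) (v : V.carrier), ψ (g • v) = α g • ψ v) (v : V.carrier) :
    V.decomp (ψ v) = (V.decomp v).map α.toMonoidHom := by
  ext g
  rw [GaloisProSet.decomp, MulAction.mem_stabilizer_iff, Subgroup.mem_map]
  constructor
  · intro h
    refine ⟨α.symm g, ?_, α.apply_symm_apply g⟩
    rw [GaloisProSet.decomp, MulAction.mem_stabilizer_iff]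
    apply ψ.injective
    rw [hψ, MulEquiv.apply_symm_apply, h]
  · rintro ⟨g', hg', rfl⟩
    rw [GaloisProSet.decomp, MulAction.mem_stabilizer_iff] at hg'
    change α g' • ψ v = ψ v
    rw [← hψ, hg']

/-- Same, for the identity automorphism: a `Π`-equivariant bijection of `V` preserves decomposition groups.
[cite: MochizukiAbsTopIII2015, Rmk 5.1.1 p.118] -/
theorem GaloisProSet.decomp_apply_eq_of_equivariant {P : Type u} [Group P] [TopologicalSpace P]
    (V : GaloisProSet P) (ψ : V.carrier ≃ V.carrier)
    (hψ : ∀ (g : P) (v : V.carrier), ψ (g • v) = g • ψ v) (v : V.carrier) :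
    V.decomp (ψ v) = V.decomp v := by
  rw [V.decomp_apply_eq_map_of_equivariant (MulEquiv.refl P) ψ (fun g v => hψ g v) v]
  ext g
  simp

namespace NumberFieldValuationProSet

open Field

variable (F : Type) [Field F] [NumberField F]

/-! ### (R1) Nonarchimedean local elements are determined by their decomposition groups -/

/-- **[NSW] Cor. 12.1.3 (nested form) on `V^non`**: `Π_A ≤ Π_B ⇒ A = B` for nonarchimedean local elements
`A, B` of `V⊚(F̄/F)`, `F` a number field. [cite: NeukirchSchmidtWingberg2008, Cor. 12.1.3] -/
theorem nonArch_eq_of_decomp_le {A B : NonArch F}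
    (h : (NumberField.valuationProSet F).decomp (Sum.inr (Sum.inl A)) ≤
      (NumberField.valuationProSet F).decomp (Sum.inr (Sum.inl B))) : A = B := by
  rw [decomp_inr_inl_eq_decompositionGroupNF, decomp_inr_inl_eq_decompositionGroupNF] at h
  exact Subtype.ext (eq_of_decompositionGroupNF_le A.1 B.1 A.2 B.2 h)

/-- `Π_A = Π_B ⇒ A = B` on `V^non`. [cite: NeukirchSchmidtWingberg2008, Cor. 12.1.3] -/
theorem nonArch_eq_of_decomp_eq {A B : NonArch F}
    (h : (NumberField.valuationProSet F).decomp (Sum.inr (Sum.inl A)) =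
      (NumberField.valuationProSet F).decomp (Sum.inr (Sum.inl B))) : A = B :=
  nonArch_eq_of_decomp_le F h.le

/-- `A ↦ Π_A` is injective on `V^non`. [cite: NeukirchSchmidtWingberg2008, Cor. 12.1.3] -/
theorem decomp_nonArch_injective :
    Function.Injective fun A : NonArch F => (NumberField.valuationProSet F).decomp (Sum.inr (Sum.inl A)) :=
  fun _ _ h => nonArch_eq_of_decomp_eq F h

/-- **"A nonarchimedean prime is uniquely determined by any open subgroup of its decomposition group"**
([NSW] Cor. 12.1.3 as quoted in Rmk 5.1.1): if `U ⊆ G_F` is an open subgroup and `U ∩ Π_A ⊆ Π_B`, then `A = B`.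
Proof: `U` has finite index in the compact group `G_F`, so `U ∩ Π_A` has finite index in `Π_A`, so `Π_A ∩ Π_B` has
finite index in `Π_A`, which forces `A = B` by non-commensurability of distinct decomposition groups
(`eq_of_relIndex_decompositionGroupNF_ne_zero`). [cite: NeukirchSchmidtWingberg2008, Cor. 12.1.3] -/
theorem nonArch_eq_of_isOpen_inf_decomp_le {A B : NonArch F} (U : Subgroup (absoluteGaloisGroup F))
    (hU : IsOpen (U : Set (absoluteGaloisGroup F)))
    (h : U ⊓ (NumberField.valuationProSet F).decomp (Sum.inr (Sum.inl A)) ≤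
      (NumberField.valuationProSet F).decomp (Sum.inr (Sum.inl B))) : A = B := by
  rw [decomp_inr_inl_eq_decompositionGroupNF, decomp_inr_inl_eq_decompositionGroupNF] at h
  refine Subtype.ext (eq_of_relIndex_decompositionGroupNF_ne_zero A.1 B.1 A.2 B.2 ?_)
  -- `U` has finite index in the compact group `G_F`
  haveI : Finite (absoluteGaloisGroup F ⧸ U) := Subgroup.quotient_finite_of_isOpen U hU
  have hU1 : U.index ≠ 0 := Subgroup.index_ne_zero_of_finite
  have hU2 : U.relIndex (decompositionGroupNF F A.1) ≠ 0 := fun h0 =>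
    hU1 (by rw [← Subgroup.relIndex_top_right]; exact Subgroup.relIndex_eq_zero_of_le_right le_top h0)
  intro h0
  apply hU2
  rw [← Subgroup.inf_relIndex_right]
  exact Subgroup.relIndex_eq_zero_of_le_left h h0

/-! ### (R2) The `hnon` binders of Rmk 5.1.1 at the genuine pro-set -/

/-- (non)-separation, nested form, at the carrier of `V⊚(F̄/F)`: for `v, w ∈ V^non`, `Π_v ≤ Π_w ⇒ v = w`.
[cite: NeukirchSchmidtWingberg2008, Cor. 12.1.3] -/
theorem eq_of_mem_non_of_decomp_le {v w : (NumberField.valuationProSet F).carrier}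
    (hv : v ∈ (NumberField.valuationProSet F).non) (hw : w ∈ (NumberField.valuationProSet F).non)
    (h : (NumberField.valuationProSet F).decomp v ≤ (NumberField.valuationProSet F).decomp w) : v = w := by
  obtain ⟨A, rfl⟩ := hv
  obtain ⟨B, rfl⟩ := hw
  rw [nonArch_eq_of_decomp_le F h]

/-- (non)-separation at the carrier: for `v, w ∈ V^non`, `Π_v = Π_w ⇒ v = w` — the `hnon` binder of
`referenceIsoUnique_of_separated` read at `V⊚(F̄/F)`. [cite: MochizukiAbsTopIII2015, Rmk 5.1.1 p.118] -/
theorem eq_of_mem_non_of_decomp_eq {v w : (NumberField.valuationProSet F).carrier}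
    (hv : v ∈ (NumberField.valuationProSet F).non) (hw : w ∈ (NumberField.valuationProSet F).non)
    (h : (NumberField.valuationProSet F).decomp v = (NumberField.valuationProSet F).decomp w) : v = w :=
  eq_of_mem_non_of_decomp_le F hv hw h.le

/-- (non)-separation, OPEN-SUBGROUP form, at the carrier: for `v, w ∈ V^non` and an open subgroup `U ⊆ G_F`,
`U ∩ Π_v ⊆ Π_w ⇒ v = w` — the `hnon` binder of `theaterHomDeterminedByGroupHom_of_separated` read at `V⊚(F̄/F)`.
[cite: MochizukiAbsTopIII2015, Rmk 5.1.1 p.118] -/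
theorem eq_of_mem_non_of_isOpen_inf_decomp_le {v w : (NumberField.valuationProSet F).carrier}
    (hv : v ∈ (NumberField.valuationProSet F).non) (hw : w ∈ (NumberField.valuationProSet F).non)
    (U : Subgroup (absoluteGaloisGroup F)) (hU : IsOpen (U : Set (absoluteGaloisGroup F)))
    (h : U ⊓ (NumberField.valuationProSet F).decomp v ≤ (NumberField.valuationProSet F).decomp w) : v = w := by
  obtain ⟨A, rfl⟩ := hv
  obtain ⟨B, rfl⟩ := hw
  rw [nonArch_eq_of_isOpen_inf_decomp_le F U hU h]

/-- **`hnon` of `referenceIsoUnique_of_separated`, verbatim shape, at `V⊚(F̄/F)`**: decomposition groups separate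
the nonarchimedean local elements. [cite: MochizukiAbsTopIII2015, Rmk 5.1.1 p.118] -/
theorem decomp_separates_non :
    ∀ v w : (NumberField.valuationProSet F).carrier, v ∈ (NumberField.valuationProSet F).non →
      w ∈ (NumberField.valuationProSet F).non →
      (NumberField.valuationProSet F).decomp v = (NumberField.valuationProSet F).decomp w → v = w :=
  fun _ _ hv hw h => eq_of_mem_non_of_decomp_eq F hv hw h

/-- **`hnon` of `theaterHomDeterminedByGroupHom_of_separated`, verbatim shape, at `V⊚(F̄/F)`**: a nonarchimedean
local element is determined by the trace of its decomposition group on any open subgroup of `G_F`.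
[cite: MochizukiAbsTopIII2015, Rmk 5.1.1 p.118] -/
theorem isOpen_inf_decomp_separates_non :
    ∀ v w : (NumberField.valuationProSet F).carrier, v ∈ (NumberField.valuationProSet F).non →
      w ∈ (NumberField.valuationProSet F).non → ∀ U : Subgroup (absoluteGaloisGroup F),
      IsOpen (U : Set (absoluteGaloisGroup F)) →
      U ⊓ (NumberField.valuationProSet F).decomp v ≤ (NumberField.valuationProSet F).decomp w → v = w :=
  fun _ _ hv hw U hU h => eq_of_mem_non_of_isOpen_inf_decomp_le F hv hw U hU h

/-! ### (R3) Uniqueness of equivariant bijections on `V^non` and on real-type `V^arc` -/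

/-- **Rmk 5.1.1 (non), unconditional at `V⊚(F̄/F)`**: for a group automorphism `α` of `G_F`, any two
`α`-equivariant bijections of `V⊚(F̄/F)` that map `V^non` into `V^non` AGREE on `V^non` (both send `v` to the
unique nonarchimedean element with decomposition group `α(Π_v)`). [cite: MochizukiAbsTopIII2015, Rmk 5.1.1 p.118] -/
theorem apply_eq_of_equivariant_of_mem_non (α : absoluteGaloisGroup F ≃* absoluteGaloisGroup F)
    (ψ₁ ψ₂ : (NumberField.valuationProSet F).carrier ≃ (NumberField.valuationProSet F).carrier)
    (h₁ : ∀ (σ : absoluteGaloisGroup F) (v : (NumberField.valuationProSet F).carrier), ψ₁ (σ • v) = α σ • ψ₁ v)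
    (h₂ : ∀ (σ : absoluteGaloisGroup F) (v : (NumberField.valuationProSet F).carrier), ψ₂ (σ • v) = α σ • ψ₂ v)
    (hn₁ : ∀ v ∈ (NumberField.valuationProSet F).non, ψ₁ v ∈ (NumberField.valuationProSet F).non)
    (hn₂ : ∀ v ∈ (NumberField.valuationProSet F).non, ψ₂ v ∈ (NumberField.valuationProSet F).non)
    {v : (NumberField.valuationProSet F).carrier} (hv : v ∈ (NumberField.valuationProSet F).non) :
    ψ₁ v = ψ₂ v :=
  eq_of_mem_non_of_decomp_eq F (hn₁ v hv) (hn₂ v hv)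
    (by rw [(NumberField.valuationProSet F).decomp_apply_eq_map_of_equivariant α ψ₁ h₁,
      (NumberField.valuationProSet F).decomp_apply_eq_map_of_equivariant α ψ₂ h₂])

/-- `α = 1`: a `G_F`-equivariant bijection of `V⊚(F̄/F)` mapping `V^non` into `V^non` FIXES every nonarchimedean
local element. [cite: MochizukiAbsTopIII2015, Rmk 5.1.1 p.118] -/
theorem apply_eq_self_of_equivariant_of_mem_non
    (ψ : (NumberField.valuationProSet F).carrier ≃ (NumberField.valuationProSet F).carrier)
    (h : ∀ (σ : absoluteGaloisGroup F) (v : (NumberField.valuationProSet F).carrier), ψ (σ • v) = σ • ψ v)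
    (hn : ∀ v ∈ (NumberField.valuationProSet F).non, ψ v ∈ (NumberField.valuationProSet F).non)
    {v : (NumberField.valuationProSet F).carrier} (hv : v ∈ (NumberField.valuationProSet F).non) :
    ψ v = v :=
  apply_eq_of_equivariant_of_mem_non F (MulEquiv.refl _) ψ (Equiv.refl _) (fun σ v => h σ v)
    (fun _ _ => rfl) hn (fun _ hv => hv) hv

/-- **Rmk 5.1.1 (arc, real type), unconditional at `V⊚(F̄/F)`**: two `α`-equivariant bijections of `V⊚(F̄/F)`
mapping `V^arc` into `V^arc` agree on every archimedean local element whose decomposition group is non-trivial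
(the elements above REAL places of `F`: `Π_w = {1, c_w}`), by injectivity of `w ↦ Π_w` there
(`decomp_arch_injective_of_ne_bot`, Artin–Schreier).  Elements above complex places (`Π_w = 1`) are NOT covered.
[cite: MochizukiAbsTopIII2015, Rmk 5.1.1 p.118] -/
theorem apply_eq_of_equivariant_of_mem_arc_of_decomp_ne_bot (α : absoluteGaloisGroup F ≃* absoluteGaloisGroup F)
    (ψ₁ ψ₂ : (NumberField.valuationProSet F).carrier ≃ (NumberField.valuationProSet F).carrier)
    (h₁ : ∀ (σ : absoluteGaloisGroup F) (v : (NumberField.valuationProSet F).carrier), ψ₁ (σ • v) = α σ • ψ₁ v)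
    (h₂ : ∀ (σ : absoluteGaloisGroup F) (v : (NumberField.valuationProSet F).carrier), ψ₂ (σ • v) = α σ • ψ₂ v)
    (ha₁ : ∀ v ∈ (NumberField.valuationProSet F).arc, ψ₁ v ∈ (NumberField.valuationProSet F).arc)
    (ha₂ : ∀ v ∈ (NumberField.valuationProSet F).arc, ψ₂ v ∈ (NumberField.valuationProSet F).arc)
    {v : (NumberField.valuationProSet F).carrier} (hv : v ∈ (NumberField.valuationProSet F).arc)
    (hne : (NumberField.valuationProSet F).decomp v ≠ ⊥) : ψ₁ v = ψ₂ v := by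
  obtain ⟨w₁, hw₁⟩ := ha₁ v hv
  obtain ⟨w₂, hw₂⟩ := ha₂ v hv
  have e₁ := (NumberField.valuationProSet F).decomp_apply_eq_map_of_equivariant α ψ₁ h₁ v
  have e₂ := (NumberField.valuationProSet F).decomp_apply_eq_map_of_equivariant α ψ₂ h₂ v
  rw [← hw₁] at e₁ ⊢
  rw [← hw₂] at e₂ ⊢
  have hinj : Function.Injective α.toMonoidHom := fun a b hab => α.injective hab
  have hne₁ : (NumberField.valuationProSet F).decomp (Sum.inr (Sum.inr w₁)) ≠ ⊥ := by
    rw [e₁]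
    exact fun h0 => hne ((Subgroup.map_eq_bot_iff_of_injective _ hinj).mp h0)
  have heq : (NumberField.valuationProSet F).decomp (Sum.inr (Sum.inr w₁)) =
      (NumberField.valuationProSet F).decomp (Sum.inr (Sum.inr w₂)) := by rw [e₁, e₂]
  rw [decomp_arch_injective_of_ne_bot F hne₁ heq]

/-- Both halves together: two `α`-equivariant bijections of `V⊚(F̄/F)` fixing `⊚` and preserving `V^non`, `V^arc`
agree at `⊚`, on all of `V^non`, and on the real-type part of `V^arc` — i.e. everywhere EXCEPT possibly at the
archimedean elements with trivial decomposition group. [cite: MochizukiAbsTopIII2015, Rmk 5.1.1 p.118] -/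
theorem apply_eq_of_equivariant_of_decomp_ne_bot (α : absoluteGaloisGroup F ≃* absoluteGaloisGroup F)
    (ψ₁ ψ₂ : (NumberField.valuationProSet F).carrier ≃ (NumberField.valuationProSet F).carrier)
    (h₁ : ∀ (σ : absoluteGaloisGroup F) (v : (NumberField.valuationProSet F).carrier), ψ₁ (σ • v) = α σ • ψ₁ v)
    (h₂ : ∀ (σ : absoluteGaloisGroup F) (v : (NumberField.valuationProSet F).carrier), ψ₂ (σ • v) = α σ • ψ₂ v)
    (hg₁ : ψ₁ (NumberField.valuationProSet F).generic = (NumberField.valuationProSet F).generic)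
    (hg₂ : ψ₂ (NumberField.valuationProSet F).generic = (NumberField.valuationProSet F).generic)
    (hn₁ : ∀ v ∈ (NumberField.valuationProSet F).non, ψ₁ v ∈ (NumberField.valuationProSet F).non)
    (hn₂ : ∀ v ∈ (NumberField.valuationProSet F).non, ψ₂ v ∈ (NumberField.valuationProSet F).non)
    (ha₁ : ∀ v ∈ (NumberField.valuationProSet F).arc, ψ₁ v ∈ (NumberField.valuationProSet F).arc)
    (ha₂ : ∀ v ∈ (NumberField.valuationProSet F).arc, ψ₂ v ∈ (NumberField.valuationProSet F).arc)
    (v : (NumberField.valuationProSet F).carrier) (hne : (NumberField.valuationProSet F).decomp v ≠ ⊥) :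
    ψ₁ v = ψ₂ v := by
  rcases (NumberField.valuationProSet F).eq_generic_or_mem v with hv | hv | hv
  · rw [hv, hg₁, hg₂]
  · exact apply_eq_of_equivariant_of_mem_non F α ψ₁ ψ₂ h₁ h₂ hn₁ hn₂ hv
  · exact apply_eq_of_equivariant_of_mem_arc_of_decomp_ne_bot F α ψ₁ ψ₂ h₁ h₂ ha₁ ha₂ hv hne

end NumberFieldValuationProSet

end Literature.AnabelianGeometry.AbsoluteAnabelian

end

/-! ## v2 (abc-iut-w6-d038 gen 3): the `hnon` binders AT THE SHADOW `shadowProVal F E`, admissible `E`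

The theorems above live at the genuine pro-set `NumberField.valuationProSet F`; abc-iut-L4-d2's shadow context sees
`shadowProVal F E = (valuationProSet F).comap (shadowHom F E)` (`GaloisTheatersNumberFieldShadow.lean`).  For
ADMISSIBLE `E`, `shadowHom F E : Π_E → G_F` is the chosen admissibility isomorphism
(`NumberFieldShadow.coe_shadowHom_of_isAdmissible`, `GaloisTheatersNumberFieldShadowDecomposition.lean`, BY NAME), so
decomposition groups at the shadow are preimages of the genuine ones under a homeomorphic group isomorphism and both
`hnon` shapes transfer.  Together with `NumberFieldShadow.induced_shadowKappa_separates_arc`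
(`NumberFieldValuationProSetArchTopologySeparationProofs.lean`, p443449) BOTH binders `hnon`/`harc` of
`GaloisTheatersRmk511.referenceIsoUnique_of_separated` / `theaterHomDeterminedByGroupHom_of_separated` are theorems at
the shadow data `(shadowProVal, shadowKappa, shadowArchSpace)` for admissible `E`. -/

noncomputable section

namespace Literature.AnabelianGeometry.AbsoluteAnabelian

namespace NumberFieldShadow

open Field

variable (F : Type) [Field F] [NumberField F]

/-- For admissible `E`, `shadowHom F E` is bijective. [cite: MochizukiAbsTopIII2015, Def 5.1 (ii) p.114] -/
theorem shadowHom_bijective_of_isAdmissible {E : FundamentalExtension.{0}} (h : IsAdmissible F E) :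
    Function.Bijective (shadowHom F E) := by
  rw [coe_shadowHom_of_isAdmissible F h]
  exact (AbsTopI.isoArith (Classical.choice h)).bijective

/-- For admissible `E`, `shadowHom F E` is an open map. [cite: MochizukiAbsTopIII2015, Def 5.1 (ii) p.114] -/
theorem isOpenMap_shadowHom_of_isAdmissible {E : FundamentalExtension.{0}} (h : IsAdmissible F E) :
    IsOpenMap (shadowHom F E) := by
  rw [coe_shadowHom_of_isAdmissible F h]
  exact (AbsTopI.isoArith (Classical.choice h)).toHomeomorph.isOpenMap

/-- Decomposition groups at the shadow are preimages of the genuine ones under `shadowHom`.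
[cite: MochizukiAbsTopIII2015, Def 5.1 (iii) p.115] -/
theorem decomp_shadowProVal (E : FundamentalExtension.{0}) (v : (shadowProVal F E).carrier) :
    (shadowProVal F E).decomp v =
      ((NumberField.valuationProSet F).decomp v).comap (shadowHom F E).toMonoidHom := by
  change ((NumberField.valuationProSet F).comap (shadowHom F E)).decomp v = _
  rw [GaloisProSet.decomp_comap]

/-- **`hnon`, equality form, at the shadow** (admissible `E`): nonarchimedean local elements of `shadowProVal F E` with
the same decomposition group in `Π_E` are equal. [cite: MochizukiAbsTopIII2015, Rmk 5.1.1 p.118] -/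
theorem shadow_eq_of_mem_non_of_decomp_eq {E : FundamentalExtension.{0}} (hE : IsAdmissible F E)
    {v w : (shadowProVal F E).carrier} (hv : v ∈ (shadowProVal F E).non) (hw : w ∈ (shadowProVal F E).non)
    (h : (shadowProVal F E).decomp v = (shadowProVal F E).decomp w) : v = w := by
  rw [decomp_shadowProVal, decomp_shadowProVal] at h
  have hsurj : Function.Surjective (shadowHom F E).toMonoidHom := (shadowHom_bijective_of_isAdmissible F hE).2
  exact NumberFieldValuationProSet.eq_of_mem_non_of_decomp_eq F hv hw (Subgroup.comap_injective hsurj h)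

/-- **`hnon`, open-subgroup form ([NSW] Cor. 12.1.3), at the shadow** (admissible `E`): for an open subgroup
`U ⊆ Π_E` and nonarchimedean `v, w`, `U ∩ Π_v ⊆ Π_w ⇒ v = w`. [cite: MochizukiAbsTopIII2015, Rmk 5.1.1 p.118] -/
theorem shadow_eq_of_mem_non_of_isOpen_inf_decomp_le {E : FundamentalExtension.{0}} (hE : IsAdmissible F E)
    {v w : (shadowProVal F E).carrier} (hv : v ∈ (shadowProVal F E).non) (hw : w ∈ (shadowProVal F E).non)
    (U : Subgroup E.arith) (hU : IsOpen (U : Set E.arith))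
    (h : U ⊓ (shadowProVal F E).decomp v ≤ (shadowProVal F E).decomp w) : v = w := by
  rw [decomp_shadowProVal, decomp_shadowProVal] at h
  have hU' : IsOpen ((U.map (shadowHom F E).toMonoidHom : Subgroup (absoluteGaloisGroup F)) :
      Set (absoluteGaloisGroup F)) := by
    rw [Subgroup.coe_map]
    exact isOpenMap_shadowHom_of_isAdmissible F hE _ hU
  refine NumberFieldValuationProSet.eq_of_mem_non_of_isOpen_inf_decomp_le F hv hw
    (U.map (shadowHom F E).toMonoidHom) hU' ?_
  intro g hg
  obtain ⟨⟨u, hu, rfl⟩, hgv⟩ := hg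
  exact h ⟨hu, hgv⟩

/-- **`hnon` of `referenceIsoUnique_of_separated`, verbatim shape, at the shadow** (admissible `E`).
[cite: MochizukiAbsTopIII2015, Rmk 5.1.1 p.118] -/
theorem decomp_separates_non_shadow {E : FundamentalExtension.{0}} (hE : IsAdmissible F E) :
    ∀ v w : (shadowProVal F E).carrier, v ∈ (shadowProVal F E).non → w ∈ (shadowProVal F E).non →
      (shadowProVal F E).decomp v = (shadowProVal F E).decomp w → v = w :=
  fun _ _ hv hw h => shadow_eq_of_mem_non_of_decomp_eq F hE hv hw h

/-- **`hnon` of `theaterHomDeterminedByGroupHom_of_separated`, verbatim shape, at the shadow** (admissible `E`).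
[cite: MochizukiAbsTopIII2015, Rmk 5.1.1 p.118] -/
theorem isOpen_inf_decomp_separates_non_shadow {E : FundamentalExtension.{0}} (hE : IsAdmissible F E) :
    ∀ v w : (shadowProVal F E).carrier, v ∈ (shadowProVal F E).non → w ∈ (shadowProVal F E).non →
      ∀ U : Subgroup E.arith, IsOpen (U : Set E.arith) →
      U ⊓ (shadowProVal F E).decomp v ≤ (shadowProVal F E).decomp w → v = w :=
  fun _ _ hv hw U hU h => shadow_eq_of_mem_non_of_isOpen_inf_decomp_le F hE hv hw U hU h

end NumberFieldShadow

end Literature.AnabelianGeometry.AbsoluteAnabelian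

end
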